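import Literature.Geometry.ComplexHyperbolic.UnitBallLieAlgebraCasimir              -- ★ (b1-II) p846527: the flat Casimir identity (π-form); brings ★ (b1-I), ★ (a1′), ★ (a1), ★ (b0), ★ (a0)
import Literature.Analysis.Calculus.LaplacianCommutatorCarreDuChamp               -- ★ (b2) FILE 1 (p09 (g2)): `weightedSecond_smul` (Leibniz for a weighted second-order operator), `iteratedFDeriv_two_apply_eq_fderiv_fderiv_apply`
import HarnessLib

/-!
# Harish-Chandra's holonomic system on `𝔲(2,1)`, the GENERATORS in the `φ_f = π·Φ_f` currency: `φ_{∂(P₁)f} = ∂_{(1,1,1)}φ_f` and `φ_{∂(ω)f} = −Δ_θ φ_f`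
# (ROAD «A6-IV» brick (b3-pre); Harish-Chandra 1957 «Differential operators on a semisimple Lie algebra» Thm. 1; Warner II §8.4.1 `φ_{∂(p)f} = ∂(p̄)φ_f`; Helgason GGA Ch. II §5)

Topic `Geometry/ComplexHyperbolic`; namespace `Literature.Geometry.ComplexHyperbolic.BallModel`.  THEOREMS ONLY (no `def`, no instance, no notation, no axiom, no named fact, no `sorry`).
Cell `pub/hodgecm-mathlib`, ENGINE T1 (crux H413 = `stmt-HodgeConjecture-24833`); ROAD A, design of record `DESIGN-A6-InHouse-v2-ArchitectureIV` 93542b84 (LEAD T11-4), SPEC fb65bd65 (b3), owner word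
R-15.6 (b3-pre); author F0P3a-p05 (g15) (ROAD A owner), 2026-09-01.

THE MATHEMATICS (`φ_f = liePhi μ f = π • Φ_f`, `π = rootProduct`, `Φ_f = lieOrbital μ f ∘ torusH`, `θ` regular, `μ` finite on compacta and right-invariant, `f ∈ C^∞_c(M₃(ℂ); E)`).
* §1 `π` CALCULUS: `Dπ(θ)[v]` explicitly (in particular `Dπ[(1,1,1)] = 0`), the second partials `∂_k∂_kπ = 2(θ₁−θ₂), −2(θ₀−θ₂), 2(θ₀−θ₁)`, hence **`Δ_θπ = 0`** (π is harmonic), and the CROSS-TERM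
  identity `2Σ_k ∂_kπ·DΦ[e_k] = 2(θ₀−θ₂)(θ₁−θ₂)DΦ[e₀−e₁] + 2(θ₀−θ₁)(θ₁−θ₂)DΦ[e₀−e₂] + 2(θ₀−θ₁)(θ₀−θ₂)DΦ[e₁−e₂]` (`= 2π·Σ_{i<j}DΦ[e_i−e_j]∕(θ_i−θ_j)`).
* §2 (E1) THE CENTRAL GENERATOR: `Ad_h(i·1) = i·1` and `torusH(1,1,1) = i·1`, so ★ (a1) at order one gives `lieOrbital μ (lieCentral f) (torusH θ) = DΦ_f(θ)[(1,1,1)]` and, `π` being translation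
  invariant along `(1,1,1)`, **`liePhi μ (lieCentral f) θ = D(liePhi μ f)(θ)[(1,1,1)]`**.
* §3 (E2) THE QUADRATIC GENERATOR IN HC's FORM: from ★ (b1-II) `rootProduct_smul_lieOrbital_lieLaplacian_torusH` (`πΦ_{∂(ω)f} + πΣ_kD²Φ[e_k,e_k] + 2Σ_k∂_kπ·∂_kΦ = 0`) and Leibniz for the flat
  Laplacian (★ (b2) `weightedSecond_smul` with `E = Pi.single`, `w = 1`) + `Δπ = 0`: **`liePhi μ (lieLaplacian f) θ = −Σ_k D²(liePhi μ f)(θ)[e_k, e_k]`** — HC's `φ_{∂(ω)f} = ∂(ω̄)φ_f` with `∂(ω̄) = −Δ_θ`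
  (`B|_𝔧 = −Σdθ²`).
* §4 THE INVARIANTS THROUGH `R`: `lieOrbital μ (invP_k • f) = invP_k • lieOrbital μ f` (★ (a0) `lieOrbital_invariant_smul` + `invP_k_conj`), `k = 1,2,3` — HC's `R(P) = p̄`, the other input of the
  commutator words of (b3) (the cubic generator via ★ (b2) `weightedSecond_tripleCommutator_smul_iteratedFDeriv`).
HONEST LABEL: HC_CM is proved only modulo the printed citations until rung 0 closes; calculus over ★ (b1)(b2), pays nothing by itself.

## References
* [HarishChandra1957DiffOps] Harish-Chandra, *Differential operators on a semisimple Lie algebra*, Amer. J. Math. 79 (1957) 87–120, Thm. 1 (`φ_{∂(p)f} = ∂(p̄)φ_f` via the radial part of `∂(ω)`).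
* [WarnerHASSLG2] G. Warner, *Harmonic Analysis on Semi-Simple Lie Groups II*, Grundlehren 189 (1972), §8.4.1.
* [Helgason2000] S. Helgason, *Groups and Geometric Analysis* (2000), Ch. II §5.
-/

set_option autoImplicit false

noncomputable section

namespace Literature.Geometry.ComplexHyperbolic

namespace BallModel

open _root_.Complex _root_.Matrix _root_.MeasureTheory _root_.Set _root_.Filter _root_.Topology
open Literature.Analysis.Calculus
open scoped Matrix.Norms.Operator ComplexConjugate ContDiff

/-! ## §1 Calculus of `π = rootProduct` -/

section RootProduct

/-- `π` is smooth (a cubic polynomial in the coordinates). [cite: WarnerHASSLG2, §8.4.1] -/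
theorem contDiff_rootProduct : ContDiff ℝ ∞ rootProduct := by
  have h : rootProduct = fun θ : Fin 3 → ℝ => (θ 0 - θ 1) * (θ 0 - θ 2) * (θ 1 - θ 2) := rfl
  rw [h]
  exact (((contDiff_apply ℝ ℝ 0).sub (contDiff_apply ℝ ℝ 1)).mul ((contDiff_apply ℝ ℝ 0).sub (contDiff_apply ℝ ℝ 2))).mul
    ((contDiff_apply ℝ ℝ 1).sub (contDiff_apply ℝ ℝ 2))

/-- **THE GRADIENT OF `π`**: `Dπ(θ)[v] = (v₀−v₁)(θ₀−θ₂)(θ₁−θ₂) + (θ₀−θ₁)(v₀−v₂)(θ₁−θ₂) + (θ₀−θ₁)(θ₀−θ₂)(v₁−v₂)`. [cite: WarnerHASSLG2, §8.4.1] -/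
theorem fderiv_rootProduct_apply (θ v : Fin 3 → ℝ) :
    fderiv ℝ rootProduct θ v = (v 0 - v 1) * (θ 0 - θ 2) * (θ 1 - θ 2) + (θ 0 - θ 1) * (v 0 - v 2) * (θ 1 - θ 2) + (θ 0 - θ 1) * (θ 0 - θ 2) * (v 1 - v 2) := by
  have h01 : HasFDerivAt (fun θ : Fin 3 → ℝ => θ 0 - θ 1) (ContinuousLinearMap.proj (R := ℝ) (φ := fun _ : Fin 3 => ℝ) 0 - ContinuousLinearMap.proj (R := ℝ) (φ := fun _ : Fin 3 => ℝ) 1) θ :=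
    (hasFDerivAt_apply 0 θ).sub (hasFDerivAt_apply 1 θ)
  have h02 : HasFDerivAt (fun θ : Fin 3 → ℝ => θ 0 - θ 2) (ContinuousLinearMap.proj (R := ℝ) (φ := fun _ : Fin 3 => ℝ) 0 - ContinuousLinearMap.proj (R := ℝ) (φ := fun _ : Fin 3 => ℝ) 2) θ :=
    (hasFDerivAt_apply 0 θ).sub (hasFDerivAt_apply 2 θ)
  have h12 : HasFDerivAt (fun θ : Fin 3 → ℝ => θ 1 - θ 2) (ContinuousLinearMap.proj (R := ℝ) (φ := fun _ : Fin 3 => ℝ) 1 - ContinuousLinearMap.proj (R := ℝ) (φ := fun _ : Fin 3 => ℝ) 2) θ :=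
    (hasFDerivAt_apply 1 θ).sub (hasFDerivAt_apply 2 θ)
  have h : HasFDerivAt (fun θ : Fin 3 → ℝ => (θ 0 - θ 1) * (θ 0 - θ 2) * (θ 1 - θ 2)) _ θ := (h01.mul h02).mul h12
  have hfun : rootProduct = fun θ : Fin 3 → ℝ => (θ 0 - θ 1) * (θ 0 - θ 2) * (θ 1 - θ 2) := rfl
  rw [hfun, h.fderiv]
  simp only [_root_.add_apply, _root_.smul_apply, _root_.sub_apply, ContinuousLinearMap.proj_apply, Pi.mul_apply, smul_eq_mul]
  ring

/-- `π` is translation-invariant along the centre direction: `Dπ(θ)[(1,1,1)] = 0`. [cite: WarnerHASSLG2, §8.4.1] -/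
theorem fderiv_rootProduct_const (θ : Fin 3 → ℝ) : fderiv ℝ rootProduct θ (fun _ => (1 : ℝ)) = 0 := by
  rw [fderiv_rootProduct_apply]; ring

/-- The partials `Dπ(·)[v]` as an explicit quadratic function (for the second derivative). [cite: WarnerHASSLG2, §8.4.1] -/
theorem fderiv_rootProduct_apply_eq_fun (v : Fin 3 → ℝ) : (fun θ : Fin 3 → ℝ => fderiv ℝ rootProduct θ v) = fun θ : Fin 3 → ℝ =>
    (v 0 - v 1) * ((θ 0 - θ 2) * (θ 1 - θ 2)) + (v 0 - v 2) * ((θ 0 - θ 1) * (θ 1 - θ 2)) + (v 1 - v 2) * ((θ 0 - θ 1) * (θ 0 - θ 2)) := by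
  funext θ
  rw [fderiv_rootProduct_apply]
  ring

/-- **THE HESSIAN OF `π`**: `D²π(θ)[u][v] = (v₀−v₁)((u₀−u₂)(θ₁−θ₂) + (θ₀−θ₂)(u₁−u₂)) + (v₀−v₂)((u₀−u₁)(θ₁−θ₂) + (θ₀−θ₁)(u₁−u₂)) + (v₁−v₂)((u₀−u₁)(θ₀−θ₂) + (θ₀−θ₁)(u₀−u₂))`.
[cite: WarnerHASSLG2, §8.4.1] -/
theorem fderiv_fderiv_rootProduct_apply (θ u v : Fin 3 → ℝ) :
    fderiv ℝ (fun z : Fin 3 → ℝ => fderiv ℝ rootProduct z v) θ u =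
      (v 0 - v 1) * ((u 0 - u 2) * (θ 1 - θ 2) + (θ 0 - θ 2) * (u 1 - u 2)) + (v 0 - v 2) * ((u 0 - u 1) * (θ 1 - θ 2) + (θ 0 - θ 1) * (u 1 - u 2)) +
        (v 1 - v 2) * ((u 0 - u 1) * (θ 0 - θ 2) + (θ 0 - θ 1) * (u 0 - u 2)) := by
  have h01 : HasFDerivAt (fun θ : Fin 3 → ℝ => θ 0 - θ 1) (ContinuousLinearMap.proj (R := ℝ) (φ := fun _ : Fin 3 => ℝ) 0 - ContinuousLinearMap.proj (R := ℝ) (φ := fun _ : Fin 3 => ℝ) 1) θ :=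
    (hasFDerivAt_apply 0 θ).sub (hasFDerivAt_apply 1 θ)
  have h02 : HasFDerivAt (fun θ : Fin 3 → ℝ => θ 0 - θ 2) (ContinuousLinearMap.proj (R := ℝ) (φ := fun _ : Fin 3 => ℝ) 0 - ContinuousLinearMap.proj (R := ℝ) (φ := fun _ : Fin 3 => ℝ) 2) θ :=
    (hasFDerivAt_apply 0 θ).sub (hasFDerivAt_apply 2 θ)
  have h12 : HasFDerivAt (fun θ : Fin 3 → ℝ => θ 1 - θ 2) (ContinuousLinearMap.proj (R := ℝ) (φ := fun _ : Fin 3 => ℝ) 1 - ContinuousLinearMap.proj (R := ℝ) (φ := fun _ : Fin 3 => ℝ) 2) θ :=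
    (hasFDerivAt_apply 1 θ).sub (hasFDerivAt_apply 2 θ)
  have h : HasFDerivAt (fun θ : Fin 3 → ℝ => (v 0 - v 1) * ((θ 0 - θ 2) * (θ 1 - θ 2)) + (v 0 - v 2) * ((θ 0 - θ 1) * (θ 1 - θ 2)) + (v 1 - v 2) * ((θ 0 - θ 1) * (θ 0 - θ 2))) _ θ :=
    (((h02.mul h12).const_mul (v 0 - v 1)).add ((h01.mul h12).const_mul (v 0 - v 2))).add ((h01.mul h02).const_mul (v 1 - v 2))
  rw [fderiv_rootProduct_apply_eq_fun, h.fderiv]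
  simp only [_root_.add_apply, _root_.smul_apply, _root_.sub_apply, ContinuousLinearMap.proj_apply, smul_eq_mul]
  ring

/-- **`π` IS HARMONIC**: `Σ_k ∂_k∂_kπ = 0` (`∂₀²π = 2(θ₁−θ₂)`, `∂₁²π = −2(θ₀−θ₂)`, `∂₂²π = 2(θ₀−θ₁)`). [cite: HarishChandra1957DiffOps, Thm. 1] [cite: Helgason2000, Ch. II §5] -/
theorem sum_fderiv_fderiv_rootProduct_single (θ : Fin 3 → ℝ) :
    ∑ k : Fin 3, fderiv ℝ (fun z : Fin 3 → ℝ => fderiv ℝ rootProduct z (Pi.single k 1)) θ (Pi.single k 1) = 0 := by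
  simp only [Fin.sum_univ_three, fderiv_fderiv_rootProduct_apply]
  simp
  ring

/-- **THE CROSS TERM**: for any real-linear functional of the direction (here `D = DΦ(θ)`),
`2Σ_k ∂_kπ·D[e_k] = 2(θ₀−θ₂)(θ₁−θ₂)·D[e₀−e₁] + 2(θ₀−θ₁)(θ₁−θ₂)·D[e₀−e₂] + 2(θ₀−θ₁)(θ₀−θ₂)·D[e₁−e₂]` (`∇π = π·Σ_{i<j}(e_i−e_j)∕(θ_i−θ_j)`). [cite: Helgason2000, Ch. II §5] -/
theorem two_smul_sum_fderiv_rootProduct_smul {E : Type*} [NormedAddCommGroup E] [NormedSpace ℝ E] (θ : Fin 3 → ℝ) (D : (Fin 3 → ℝ) →L[ℝ] E) :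
    (2 : ℝ) • ∑ k : Fin 3, fderiv ℝ rootProduct θ (Pi.single k 1) • D (Pi.single k 1) =
      (2 * ((θ 0 - θ 2) * (θ 1 - θ 2))) • D (Pi.single 0 1 - Pi.single 1 1) + (2 * ((θ 0 - θ 1) * (θ 1 - θ 2))) • D (Pi.single 0 1 - Pi.single 2 1) +
        (2 * ((θ 0 - θ 1) * (θ 0 - θ 2))) • D (Pi.single 1 1 - Pi.single 2 1) := by
  simp only [Fin.sum_univ_three, fderiv_rootProduct_apply, map_sub]
  simp
  module

end RootProduct

/-! ## §2 (E1) The central generator -/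

section Central

variable {E : Type*} [NormedAddCommGroup E] [NormedSpace ℝ E] [CompleteSpace E]

/-- `torusH(1,1,1) = i·1`. [cite: WarnerHASSLG2, §8.4.1] -/
theorem torusH_one : torusH (fun _ : Fin 3 => (1 : ℝ)) = I • (1 : Matrix (Fin 3) (Fin 3) ℂ) := by
  rw [torusH_const]; simp

/-- `Ad_h(i·1) = i·1`. [cite: WarnerHASSLG2, §8.4.1] -/
theorem conj_I_smul_one (h : U21) : mat h * (I • (1 : Matrix (Fin 3) (Fin 3) ℂ)) * mat h⁻¹ = I • (1 : Matrix (Fin 3) (Fin 3) ℂ) := by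
  rw [Matrix.mul_smul, Matrix.mul_one, Matrix.smul_mul, ← mat_mul, mul_inv_cancel, mat_one]

/-- **(E1) AT THE `Φ` LEVEL**: `lieOrbital μ (lieCentral f) (torusH θ) = DΦ_f(θ)[(1,1,1)]` off the noncompact walls (★ (a1) at order one; `Ad` fixes the centre).
[cite: WarnerHASSLG2, §8.4.1] -/
theorem lieOrbital_lieCentral_torusH (μ : Measure U21) [IsFiniteMeasureOnCompacts μ] {f : Matrix (Fin 3) (Fin 3) ℂ → E} (hf : ContDiff ℝ ∞ f) (hfc : HasCompactSupport f)
    (θ : Fin 3 → ℝ) (h02 : θ 0 ≠ θ 2) (h12 : θ 1 ≠ θ 2) :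
    lieOrbital μ (lieCentral f) (torusH θ) = fderiv ℝ (fun θ' : Fin 3 → ℝ => lieOrbital μ f (torusH θ')) θ (fun _ => (1 : ℝ)) := by
  rw [← integral_fderiv_conj_torusH_torusH μ hf hfc θ h02 h12 (fun _ => (1 : ℝ)), lieOrbital_def]
  refine integral_congr_ae (Eventually.of_forall fun h => ?_)
  beta_reduce
  rw [lieCentral_def, torusH_one, conj_I_smul_one]

omit [CompleteSpace E] in
/-- `liePhi` is `π • Φ` as a function. [cite: WarnerHASSLG2, §8.4.1] -/
theorem liePhi_eq_smul_fun (μ : Measure U21) (f : Matrix (Fin 3) (Fin 3) ℂ → E) :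
    liePhi μ f = fun θ : Fin 3 → ℝ => rootProduct θ • lieOrbital μ f (torusH θ) := by
  funext θ; rw [liePhi_def]

/-- **(E1) THE CENTRAL GENERATOR**: `liePhi μ (lieCentral f) θ = D(liePhi μ f)(θ)[(1,1,1)]` at a regular `θ` (`Dπ[(1,1,1)] = 0`). [cite: HarishChandra1957DiffOps, Thm. 1] [cite: WarnerHASSLG2, §8.4.1] -/
theorem liePhi_lieCentral (μ : Measure U21) [IsFiniteMeasureOnCompacts μ] {f : Matrix (Fin 3) (Fin 3) ℂ → E} (hf : ContDiff ℝ ∞ f) (hfc : HasCompactSupport f)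
    (θ : Fin 3 → ℝ) (h02 : θ 0 ≠ θ 2) (h12 : θ 1 ≠ θ 2) :
    liePhi μ (lieCentral f) θ = fderiv ℝ (liePhi μ f) θ (fun _ => (1 : ℝ)) := by
  have hΦ : DifferentiableAt ℝ (fun θ' : Fin 3 → ℝ => lieOrbital μ f (torusH θ')) θ :=
    (contDiffAt_lieOrbital_torusH μ hf hfc θ h02 h12).differentiableAt (by simp)
  have hπ : DifferentiableAt ℝ rootProduct θ := contDiff_rootProduct.contDiffAt.differentiableAt (by simp)
  rw [liePhi_eq_smul_fun μ f, fderiv_smul_apply_eq_of_differentiableAt hπ hΦ, fderiv_rootProduct_const, zero_smul, zero_add, liePhi_def,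
    lieOrbital_lieCentral_torusH μ hf hfc θ h02 h12]

end Central

/-! ## §3 (E2) The quadratic generator: `φ_{∂(ω)f} = −Δ_θ φ_f` -/

section Quadratic

variable {E : Type*} [NormedAddCommGroup E] [NormedSpace ℝ E] [CompleteSpace E]

/-- **(E2) HARISH-CHANDRA's EQUATION FOR THE CASIMIR**: for `μ` finite on compacta and right-invariant, `f ∈ C^∞_c(M₃(ℂ); E)` and a regular `θ`,
`liePhi μ (lieLaplacian f) θ = −Σ_k D²(liePhi μ f)(θ)[e_k, e_k]` — `φ_{∂(ω)f} = ∂(ω̄)φ_f`, `∂(ω̄) = −Δ_θ` (★ (b1-II) π-form + Leibniz ★ (b2) `weightedSecond_smul` + `Δπ = 0`).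
[cite: HarishChandra1957DiffOps, Thm. 1] [cite: WarnerHASSLG2, §8.4.1] [cite: Helgason2000, Ch. II §5] -/
theorem liePhi_lieLaplacian (μ : Measure U21) [IsFiniteMeasureOnCompacts μ] [μ.IsMulRightInvariant] {f : Matrix (Fin 3) (Fin 3) ℂ → E} (hf : ContDiff ℝ ∞ f)
    (hfc : HasCompactSupport f) (θ : Fin 3 → ℝ) (hθ : rootProduct θ ≠ 0) :
    liePhi μ (lieLaplacian f) θ = -(∑ k : Fin 3, iteratedFDeriv ℝ 2 (liePhi μ f) θ ![Pi.single k 1, Pi.single k 1]) := by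
  obtain ⟨h01, h02, h12⟩ := sub_ne_zero_of_rootProduct_ne_zero hθ
  have h02' : θ 0 ≠ θ 2 := sub_ne_zero.1 h02
  have h12' : θ 1 ≠ θ 2 := sub_ne_zero.1 h12
  -- smoothness at `θ`
  have hΦ : ContDiffAt ℝ 2 (fun θ' : Fin 3 → ℝ => lieOrbital μ f (torusH θ')) θ := (contDiffAt_lieOrbital_torusH μ hf hfc θ h02' h12').of_le (by norm_cast)
  have hπ : ContDiffAt ℝ 2 rootProduct θ := contDiff_rootProduct.contDiffAt.of_le (by norm_cast)
  -- Leibniz for the flat Laplacian `L χ y = Σ_k ∂_k∂_k χ` (★ (b2) `weightedSecond_smul`, `E = e_k`, `w = 1`)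
  have hL := weightedSecond_smul (V := Fin 3 → ℝ) (G := E) (w := fun _ : Fin 3 => (1 : ℝ)) (E := fun k : Fin 3 => (Pi.single k 1 : Fin 3 → ℝ))
    (fun χ y => ∑ k : Fin 3, (1 : ℝ) • fderiv ℝ (fun z => fderiv ℝ χ z (Pi.single k 1)) y (Pi.single k 1)) (fun _ _ => rfl) hπ hΦ
  simp only [one_smul] at hL
  -- the product `π • Φ` is `liePhi`
  have hprod : (fun z : Fin 3 → ℝ => rootProduct z • lieOrbital μ f (torusH z)) = liePhi μ f := (liePhi_eq_smul_fun μ f).symm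
  rw [hprod, sum_fderiv_fderiv_rootProduct_single θ, zero_smul, add_zero] at hL
  -- convert the `iteratedFDeriv` normal form to the nested form
  have hliePhi2 : ContDiffAt ℝ 2 (liePhi μ f) θ := by rw [← hprod]; exact hπ.smul hΦ
  have hconv : ∀ k : Fin 3, iteratedFDeriv ℝ 2 (liePhi μ f) θ ![Pi.single k 1, Pi.single k 1] = fderiv ℝ (fun z => fderiv ℝ (liePhi μ f) z (Pi.single k 1)) θ (Pi.single k 1) :=
    fun k => iteratedFDeriv_two_apply_eq_fderiv_fderiv_apply hliePhi2 _ _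
  have hconvΦ : ∀ k : Fin 3, iteratedFDeriv ℝ 2 (fun θ' : Fin 3 → ℝ => lieOrbital μ f (torusH θ')) θ ![Pi.single k 1, Pi.single k 1] =
      fderiv ℝ (fun z => fderiv ℝ (fun θ' : Fin 3 → ℝ => lieOrbital μ f (torusH θ')) z (Pi.single k 1)) θ (Pi.single k 1) :=
    fun k => iteratedFDeriv_two_apply_eq_fderiv_fderiv_apply hΦ _ _
  simp only [hconv]
  rw [hL]
  -- the π-form of the flat Casimir identity
  have hπform := rootProduct_smul_lieOrbital_lieLaplacian_torusH μ hf hfc θ hθ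
  simp only [hconvΦ] at hπform
  rw [two_smul_sum_fderiv_rootProduct_smul θ (fderiv ℝ (fun θ' : Fin 3 → ℝ => lieOrbital μ f (torusH θ')) θ), liePhi_def]
  -- linear algebra: `a = −(b + c)` from `a + b + c = 0`
  have key : rootProduct θ • lieOrbital μ (lieLaplacian f) (torusH θ) =
      -(rootProduct θ • ∑ k : Fin 3, fderiv ℝ (fun z => fderiv ℝ (fun θ' : Fin 3 → ℝ => lieOrbital μ f (torusH θ')) z (Pi.single k 1)) θ (Pi.single k 1) +
        ((2 * ((θ 0 - θ 2) * (θ 1 - θ 2))) • fderiv ℝ (fun θ' : Fin 3 → ℝ => lieOrbital μ f (torusH θ')) θ (Pi.single 0 1 - Pi.single 1 1) +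
          (2 * ((θ 0 - θ 1) * (θ 1 - θ 2))) • fderiv ℝ (fun θ' : Fin 3 → ℝ => lieOrbital μ f (torusH θ')) θ (Pi.single 0 1 - Pi.single 2 1) +
          (2 * ((θ 0 - θ 1) * (θ 0 - θ 2))) • fderiv ℝ (fun θ' : Fin 3 → ℝ => lieOrbital μ f (torusH θ')) θ (Pi.single 1 1 - Pi.single 2 1))) := by
    rw [eq_neg_iff_add_eq_zero, ← hπform]
    abel
  rw [key, Finset.smul_sum]

end Quadratic

/-! ## §4 The invariant polynomials through `R` -/

section Invariants

variable {E : Type*} [NormedAddCommGroup E] [NormedSpace ℝ E]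

/-- **`R(P₁) = p̄₁`**: `lieOrbital μ (invP₁ • f) X = invP₁ X • lieOrbital μ f X`. [cite: WarnerHASSLG2, §8.4.1] -/
theorem lieOrbital_invP₁_smul (μ : Measure U21) (f : Matrix (Fin 3) (Fin 3) ℂ → E) (X : Matrix (Fin 3) (Fin 3) ℂ) :
    lieOrbital μ (fun Y => invP₁ Y • f Y) X = invP₁ X • lieOrbital μ f X :=
  lieOrbital_invariant_smul μ f invP₁ invP₁_conj X

/-- **`R(P₂) = p̄₂`**. [cite: WarnerHASSLG2, §8.4.1] -/
theorem lieOrbital_invP₂_smul (μ : Measure U21) (f : Matrix (Fin 3) (Fin 3) ℂ → E) (X : Matrix (Fin 3) (Fin 3) ℂ) :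
    lieOrbital μ (fun Y => invP₂ Y • f Y) X = invP₂ X • lieOrbital μ f X :=
  lieOrbital_invariant_smul μ f invP₂ invP₂_conj X

/-- **`R(P₃) = p̄₃`**. [cite: WarnerHASSLG2, §8.4.1] -/
theorem lieOrbital_invP₃_smul (μ : Measure U21) (f : Matrix (Fin 3) (Fin 3) ℂ → E) (X : Matrix (Fin 3) (Fin 3) ℂ) :
    lieOrbital μ (fun Y => invP₃ Y • f Y) X = invP₃ X • lieOrbital μ f X :=
  lieOrbital_invariant_smul μ f invP₃ invP₃_conj X

/-- On the torus `p̄₃ = −(θ₀³+θ₁³+θ₂³)`, so `liePhi μ (invP₃ • f) θ = −(θ₀³+θ₁³+θ₂³) • liePhi μ f θ`. [cite: WarnerHASSLG2, §8.4.1] -/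
theorem liePhi_invP₃_smul (μ : Measure U21) (f : Matrix (Fin 3) (Fin 3) ℂ → E) (θ : Fin 3 → ℝ) :
    liePhi μ (fun Y => invP₃ Y • f Y) θ = (-(θ 0 ^ 3 + θ 1 ^ 3 + θ 2 ^ 3)) • liePhi μ f θ := by
  rw [liePhi_def, liePhi_def, lieOrbital_invP₃_smul, invP₃_torusH, smul_comm]

/-- On the torus `p̄₁ = θ₀+θ₁+θ₂`, so `liePhi μ (invP₁ • f) θ = (θ₀+θ₁+θ₂) • liePhi μ f θ`. [cite: WarnerHASSLG2, §8.4.1] -/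
theorem liePhi_invP₁_smul (μ : Measure U21) (f : Matrix (Fin 3) (Fin 3) ℂ → E) (θ : Fin 3 → ℝ) :
    liePhi μ (fun Y => invP₁ Y • f Y) θ = (θ 0 + θ 1 + θ 2) • liePhi μ f θ := by
  rw [liePhi_def, liePhi_def, lieOrbital_invP₁_smul, invP₁_torusH, smul_comm]

end Invariants

end BallModel

end Literature.Geometry.ComplexHyperbolic

end
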